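/-
Copyright (c) 2026 the pub-hodgecm-mathlib formalisation cell (harness21).  Prover seat hodgecm-mathlib-F0P2-p06 (g10), 2026-09-01.  Road «S3-tree» (architect A-p16 (g30) A-88 (8)),
brick T3′ «depth-zero κ-transfer», population (P-2) TYPE (2), row (R0²): organ FILE γ₂ «THE TYPE-(2) CAYLEY SHIFT AT A CM PLACE» — the shifted endoscopic pair `(γ_H′, δ′)`
on the `cmDatum` carriers: existence, `ι(γ_H′) = φ(ι(γ_H))`, matching and κ are kept, the ★ value theorems' binders at the shifted exponents, and the shifted-order memberships
that ★ ROW-0 = #FIX(Y) consumes.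
-/
import Literature.NumberTheory.Automorphic.TypeTwoMoebiusShiftValued                 -- ★ FILE γ₁ p846420 (this seat) over ★ α p846376, ★ β p846386
import Literature.NumberTheory.Rogawski1990.FinExplicitTransferFactorKappaEvenEigenline  -- ★ `exists_eigenvector_of_finKappaAt_ne_zero`; brings ★ `finKappaAt_eq_ite_of_eigenvector`
import Literature.NumberTheory.Rogawski1990.FinExplicitTransferFactorNondegenerate     -- ★ `isUnit_eval_finCharpolyTwo_of_isLocalGRegular`
import Literature.NumberTheory.Automorphic.AnisotropicUnitaryGroupCompactOfPlace       -- ★ `conjLocal_apply_eq_of_smul_eq`, `localGram_apply_apply`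
import Literature.NumberTheory.Automorphic.CMLocalRankOneClassMapOpen                  -- ★ `placeForm_antidiagTwo_eq`
import Literature.NumberTheory.Automorphic.LocalUnitaryIntegralLevel                   -- ★ `localNonsplitEquiv`, `mem_localIntegralLevel_iff_of_smul_eq`
import Literature.NumberTheory.Automorphic.AdicCompletionIntegersAdicComplete          -- ★ `integer_valuation_eq_valuedInteger`
import Literature.NumberTheory.Automorphic.IdeleUnitBoxSplittingConstants              -- ★ `valued_eq_one_iff_valuation_eq_one`
import Literature.NumberTheory.Automorphic.AddCharConductorExponent                    -- ★ `valuation_le_valuation_iff_valued`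
import HarnessLib

/-!
# The type-(2) Cayley shift at a CM place: `(γ_H, δ) ↦ (γ_H′, δ′) = (φγ_H, φδ)` on the `cmDatum` carriers

Topic `NumberTheory/Rogawski1990`; namespace `Literature.NumberTheory.Rogawski1990`.  THEOREMS ONLY (no definition, no instance, no notation, no named fact, no `sorry`); kernel lane
`--supports stmt-HodgeConjecture-24833`.  Cell `pub/hodgecm-mathlib`, crux H413; road «S3-tree», brick T3′ «depth-zero κ-transfer» (HEAD v4 clause `depthZeroKappaTransfer_hyperspecial_typeTwo`,
P-2 assembly holder F0P2-p06 (g10)), row (R0²) of the ★ type-(2) socket p846003 (census `F0/P2/F0P2-p06/g10/CENSUS-T3prime-P2-assembly.F0P2p06g10.md` §3 (c)(d)).  HONEST LABEL: HC_CM is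
proved only modulo the cell's 2 remaining named inputs (hLiu418, h413) until rung 0 closes; this file is an ASSEMBLY over ★ material and asserts nothing printed.

THE MATHEMATICS.  `φ_c(M) = ((c+1)M + (c−1))((c−1)M + (c+1))⁻¹` with `c ∈ E_v = ∏_{w∣v} L_w` fixed by `c ⊗ 1` (in the application `c = ι_v(ϖ_v)`).  §1 (generic ring): `φ` of a
unitary is unitary (★ α), so `φ` acts on `U(σ, H)`-points; the ring form of the eigenvector rule; conjugation transports `𝒪[A]`-membership.  §2 on the carriers
`(cmDatum L N H).Local v`: the shifted elements `γ_H′ = (φg, φu)`, `δ′ = φδ` EXIST (`Matrix.nonsingInvUnit`), `ι_v(γ_H′) = φ(ι_v(γ_H))` (★ α `moebius_reindex` ∘ `moebius_fromBlocks`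
on `ι_v = reindex endoPerm ∘ fromBlocks`), `ι_v(γ_H) ↔ δ ⇒ ι_v(γ_H′) ↔ δ′` (★ α `moebius_conj`), and `κ_v(γ_H′, δ′) = κ_v(γ_H, δ)` (the `u`-eigenvector of `δ` is the `φu`-eigenvector
of `δ′`; ★ `finKappaAt_eq_ite_of_eigenvector` twice).  §3 at the place `w` (`K = L_w`, `c_w` with `|c_w| = exp(−1)`): the ★ value theorems' binders for `γ_H′` at the SHIFTED
exponents — `hN′ : |disc χ_{g′}|_w = exp(−(2(N−1)+1))`, `hn′ : |χ_{g′}(u′)|_w = exp(−(n−2))`, `hirr′`, `hreg′ : IsLocalGRegular` (separability at `w`, lifted along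
`E_v ≃+* L_w` at a non-split `v`), `hint′` — all from ★ γ₁ given `γ_H ∈ V`: `g_w ≡ 1`, `u_w ≡ 1 (mod c_w)` entrywise.  §4 the SHIFTED-ORDER MEMBERSHIPS of `Y = (δ′)_w`:
`Y, Y⁻¹ ∈ 𝒪_w[X_δ]`, `X_δ ∈ 𝒪_w[Y]`, `X_δ = 1 + c_w⁻¹(δ_w − 1)` (★ α §4 on `W_H = c_w⁻¹(ι(γ_H)_w − 1)`, conjugated by the matching `x_w`), i.e. the hypotheses `hY hY′ hX` of ★
`ncard_fixedBy_rankStratum_zero_eq_natCard_fixedBy_of_mem_adjoin` (ROW-0 = #FIX(Y)).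

## References
* [Rogawski1990] J. D. Rogawski, *Automorphic Representations of Unitary Groups in Three Variables* (1990), §4.9 Prop. 4.9.1 (b) p. 55; §4.3 p. 43; §14.6 p. 242.
* [Kottwitz1986] R. E. Kottwitz, *Base change for unit elements of Hecke algebras*, Compositio Math. 60 (1986), §3.
* [LanglandsShelstad1987] R. P. Langlands, D. Shelstad, *On the definition of transfer factors*, Math. Ann. 278 (1987), §1.3–1.4.
* [Flicker1998UnitaryFL] Y. Z. Flicker, *Elementary proof of the fundamental lemma for a unitary group*, Canad. J. Math. 50 (1998), §6.
-/

set_option autoImplicit false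

noncomputable section

open NumberField IsDedekindDomain Matrix Polynomial
open scoped MatrixGroups WithZero

namespace Literature.NumberTheory.Rogawski1990

open Literature.NumberTheory.Automorphic Literature.NumberTheory.Automorphic.UnitaryGroup Literature.NumberTheory.Automorphic.MoebiusShift
open Literature.NumberTheory.GaloisRepresentations Literature.NumberTheory.NumberFields

/-! ## §1 Generic: `φ` on `U(σ, H)`-points, the ring form of the eigenvector rule, conjugation of orders -/

section Generic

variable {R : Type*} [CommRing R] {n : Type*} [Fintype n] [DecidableEq n]

/-- **`φ` of a unitary point is a unitary point**: for `x ∈ U(σ, H)`, `σ a = a`, `σ b = b`, `det(bx + a)`, `det(ax + b)` units, there is `y ∈ U(σ, H)` with matrix `(ax + b)(bx + a)⁻¹`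
(★ FILE α `transpose_map_moebius_mul_mul`, `Matrix.nonsingInvUnit`). [cite: Kottwitz1986, §3] [cite: Rogawski1990, §4.9 Prop. 4.9.1 (b) p. 55] -/
theorem exists_unitary_coe_eq_moebius {σ : R →+* R} {H : Matrix n n R} (x : ↥(unitaryGroupOfForm σ H)) {a b : R} (ha : σ a = a) (hb : σ b = b)
    (hD : IsUnit (b • ((x : GL n R) : Matrix n n R) + a • (1 : Matrix n n R)).det) (hN : IsUnit (a • ((x : GL n R) : Matrix n n R) + b • (1 : Matrix n n R)).det) :
    ∃ y : ↥(unitaryGroupOfForm σ H), ((y : GL n R) : Matrix n n R) = (a • ((x : GL n R) : Matrix n n R) + b • 1) * (b • ((x : GL n R) : Matrix n n R) + a • 1)⁻¹ := by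
  have hdet : IsUnit ((a • ((x : GL n R) : Matrix n n R) + b • 1) * (b • ((x : GL n R) : Matrix n n R) + a • 1)⁻¹).det := by
    rw [Matrix.det_mul]; exact hN.mul (Matrix.isUnit_nonsing_inv_det _ hD)
  refine ⟨⟨Matrix.nonsingInvUnit _ hdet, ?_⟩, rfl⟩
  rw [mem_unitaryGroupOfForm_iff]
  exact transpose_map_moebius_mul_mul σ H _ x.2 ha hb hD

/-- **The ring form of the eigenvector rule**: `Mp = μp`, `bμ + a` a unit ⇒ `φ(M)p = ((aμ + b)·(bμ + a)⁻¹)p` with `Ring.inverse`. [cite: Kottwitz1986, §3] -/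
theorem moebius_mulVec_of_eigenvector_ring {M : Matrix n n R} {p : n → R} {μ : R} (hp : M *ᵥ p = μ • p) {a b : R} (hμ : IsUnit (b * μ + a))
    (hD : IsUnit (b • M + a • (1 : Matrix n n R)).det) :
    ((a • M + b • (1 : Matrix n n R)) * (b • M + a • (1 : Matrix n n R))⁻¹) *ᵥ p = ((a * μ + b) * Ring.inverse (b * μ + a)) • p := by
  have h2 : (b * μ + a) • ((b • M + a • (1 : Matrix n n R))⁻¹ *ᵥ p) = p := by
    have h3 : (b • M + a • (1 : Matrix n n R))⁻¹ *ᵥ ((b • M + a • (1 : Matrix n n R)) *ᵥ p) = p := by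
      rw [Matrix.mulVec_mulVec, Matrix.nonsing_inv_mul _ hD, Matrix.one_mulVec]
    rwa [smul_add_smul_one_mulVec_of_eigenvector hp, Matrix.mulVec_smul] at h3
  have h1 : (b • M + a • (1 : Matrix n n R))⁻¹ *ᵥ p = Ring.inverse (b * μ + a) • p := by
    calc (b • M + a • (1 : Matrix n n R))⁻¹ *ᵥ p = Ring.inverse (b * μ + a) • ((b * μ + a) • ((b • M + a • (1 : Matrix n n R))⁻¹ *ᵥ p)) := by
          rw [smul_smul, Ring.inverse_mul_cancel _ hμ, one_smul]
      _ = Ring.inverse (b * μ + a) • p := by rw [h2]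
  rw [← Matrix.mulVec_mulVec, h1, Matrix.mulVec_smul, smul_add_smul_one_mulVec_of_eigenvector hp, smul_smul, mul_comm]

/-- The Möbius shift of a `1 × 1` matrix `(u)`: its entry is `(au + b)·(bu + a)⁻¹`. [cite: Kottwitz1986, §3] -/
theorem moebius_fin_one_apply (U : Matrix (Fin 1) (Fin 1) R) (a b : R) :
    ((a • U + b • (1 : Matrix (Fin 1) (Fin 1) R)) * (b • U + a • (1 : Matrix (Fin 1) (Fin 1) R))⁻¹) 0 0 = (a * U 0 0 + b) * Ring.inverse (b * U 0 0 + a) := by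
  rw [Matrix.inv_def, Matrix.adjugate_fin_one, Matrix.det_fin_one, Matrix.mul_smul, Matrix.mul_one, Matrix.smul_apply, smul_eq_mul, mul_comm]
  simp

/-- **Conjugation transports orders**: `B ∈ 𝒪[A] ⇒ PBP⁻¹ ∈ 𝒪[PAP⁻¹]` for `P ∈ GL_n` (polynomial induction). [cite: Kottwitz1986, §3] -/
theorem conj_mem_adjoin_of_mem_adjoin {K : Type*} [Field K] (O : Subring K) (P : GL n K) {A B : Matrix n n K} (h : B ∈ Algebra.adjoin O ({A} : Set (Matrix n n K))) :
    (P : Matrix n n K) * B * ((P⁻¹ : GL n K) : Matrix n n K) ∈ Algebra.adjoin O ({(P : Matrix n n K) * A * ((P⁻¹ : GL n K) : Matrix n n K)} : Set (Matrix n n K)) := by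
  rw [Algebra.adjoin_singleton_eq_range_aeval] at h
  rw [Algebra.adjoin_singleton_eq_range_aeval]
  obtain ⟨q, rfl⟩ := h
  refine ⟨q, ?_⟩
  have hPP : ((P⁻¹ : GL n K) : Matrix n n K) * (P : Matrix n n K) = 1 := by rw [← Units.val_mul, inv_mul_cancel, Units.val_one]
  induction q using Polynomial.induction_on' with
  | add p q hp hq => simp only [map_add, AlgHom.toRingHom_eq_coe, RingHom.coe_coe] at hp hq ⊢; rw [hp, hq, Matrix.mul_add, Matrix.add_mul]
  | monomial k r =>
      simp only [AlgHom.toRingHom_eq_coe, RingHom.coe_coe, aeval_monomial, Algebra.algebraMap_eq_smul_one, smul_mul_assoc, one_mul]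
      rw [Matrix.mul_smul, Matrix.smul_mul]
      congr 1
      induction k with
      | zero => rw [pow_zero, pow_zero, Matrix.mul_one, ← Units.val_mul, mul_inv_cancel, Units.val_one]
      | succ k ih =>
          rw [pow_succ, ih, pow_succ]
          simp only [Matrix.mul_assoc]
          rw [← Matrix.mul_assoc ((P⁻¹ : GL n K) : Matrix n n K) (P : Matrix n n K), hPP, Matrix.one_mul]

/-- `𝒪[1 + W] = 𝒪[W]`-membership helper: `B ∈ 𝒪[W] ⇒ B ∈ 𝒪[1 + W]`. [cite: Kottwitz1986, §3] -/
theorem mem_adjoin_one_add_of_mem_adjoin {K : Type*} [Field K] (O : Subring K) {W B : Matrix n n K} (h : B ∈ Algebra.adjoin O ({W} : Set (Matrix n n K))) :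
    B ∈ Algebra.adjoin O ({1 + W} : Set (Matrix n n K)) := by
  have hle : Algebra.adjoin O ({W} : Set (Matrix n n K)) ≤ Algebra.adjoin O ({1 + W} : Set (Matrix n n K)) := by
    rw [Algebra.adjoin_le_iff, Set.singleton_subset_iff, SetLike.mem_coe]
    have h1 : (1 + W) - 1 ∈ Algebra.adjoin O ({1 + W} : Set (Matrix n n K)) := sub_mem (Algebra.self_mem_adjoin_singleton O (1 + W)) (Subalgebra.one_mem _)
    rwa [add_sub_cancel_left] at h1
  exact hle h

/-- `B ∈ 𝒪[Y] ⇒ 1 + B ∈ 𝒪[Y]`. [cite: Kottwitz1986, §3] -/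
theorem one_add_mem_adjoin_of_mem {K : Type*} [Field K] (O : Subring K) {Y B : Matrix n n K} (h : B ∈ Algebra.adjoin O ({Y} : Set (Matrix n n K))) :
    1 + B ∈ Algebra.adjoin O ({Y} : Set (Matrix n n K)) :=
  add_mem (Subalgebra.one_mem _) h

/-- `(A⁻¹).map f = (A.map f)⁻¹` for an invertible `A` (ring homomorphisms commute with the adjugate formula). [cite: Kottwitz1986, §3] -/
theorem map_nonsing_inv_of_isUnit {S : Type*} [CommRing S] (f : R →+* S) (A : Matrix n n R) (hA : IsUnit A.det) : (A⁻¹).map f = (A.map f)⁻¹ := by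
  refine (Matrix.inv_eq_right_inv ?_).symm
  rw [← Matrix.map_mul, Matrix.mul_nonsing_inv _ hA, Matrix.map_one f (map_zero f) (map_one f)]

/-- `φ` commutes with entrywise ring homomorphisms (denominator invertible). [cite: Kottwitz1986, §3] -/
theorem map_moebius {S : Type*} [CommRing S] (f : R →+* S) (M : Matrix n n R) (a b : R) (hD : IsUnit (b • M + a • (1 : Matrix n n R)).det) :
    ((a • M + b • (1 : Matrix n n R)) * (b • M + a • (1 : Matrix n n R))⁻¹).map f = (f a • M.map f + f b • (1 : Matrix n n S)) * (f b • M.map f + f a • (1 : Matrix n n S))⁻¹ := by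
  have hlin : ∀ x y : R, (x • M + y • (1 : Matrix n n R)).map f = f x • M.map f + f y • (1 : Matrix n n S) := fun x y => by
    ext i j; simp [Matrix.map_apply, Matrix.one_apply, apply_ite f]
  rw [Matrix.map_mul, map_nonsing_inv_of_isUnit f _ hD, hlin, hlin]

end Generic


/-! ## §2 On the `cmDatum` carriers: the shifted elements exist, `ι(γ_H′) = φ(ι(γ_H))`, matching and κ are kept -/

section Carriers

variable (L : Type) [Field L] [NumberField L] [IsCMField L] (v : HeightOneSpectrum (𝓞 ↥(maximalRealSubfield L)))

/-- **The shifted element exists on `U(H)(L⁺_v)`**: for `x ∈ (cmDatum L N H).Local v` and `c ∈ E_v` fixed by `c ⊗ 1` with both Möbius sides of `x` invertible, there is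
`y ∈ (cmDatum L N H).Local v` with matrix `φ_c(x) = ((c+1)x + (c−1))((c−1)x + (c+1))⁻¹`. [cite: Kottwitz1986, §3] [cite: Rogawski1990, §4.9 Prop. 4.9.1 (b) p. 55] -/
theorem exists_local_coe_eq_moebius (N : ℕ) (H : Matrix (Fin N) (Fin N) L) (x : (cmDatum L N H).Local v) {c : LocalRing L v}
    (hσc : conjLocal L (IsCMField.complexConj L) v c = c)
    (hD : IsUnit ((c - 1) • ((x.val : GL (Fin N) (LocalRing L v)).val : Matrix (Fin N) (Fin N) (LocalRing L v)) + (c + 1) • (1 : Matrix (Fin N) (Fin N) (LocalRing L v))).det)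
    (hN : IsUnit ((c + 1) • ((x.val : GL (Fin N) (LocalRing L v)).val : Matrix (Fin N) (Fin N) (LocalRing L v)) + (c - 1) • (1 : Matrix (Fin N) (Fin N) (LocalRing L v))).det) :
    ∃ y : (cmDatum L N H).Local v, ((y.val : GL (Fin N) (LocalRing L v)).val : Matrix (Fin N) (Fin N) (LocalRing L v)) =
      ((c + 1) • ((x.val : GL (Fin N) (LocalRing L v)).val : Matrix (Fin N) (Fin N) (LocalRing L v)) + (c - 1) • 1) *
        ((c - 1) • ((x.val : GL (Fin N) (LocalRing L v)).val : Matrix (Fin N) (Fin N) (LocalRing L v)) + (c + 1) • 1)⁻¹ :=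
  exists_unitary_coe_eq_moebius (σ := conjLocal L (IsCMField.complexConj L) v) x (by rw [map_add, hσc, map_one]) (by rw [map_sub, hσc, map_one]) hD hN

set_option maxHeartbeats 400000 in
-- the carriers' types are large
/-- **`ι_v(γ_H′) = φ(ι_v(γ_H))`**: the endoscopic embedding commutes with the Möbius shift (`ι_v = reindex endoPerm ∘ fromBlocks`; ★ α `moebius_reindex`, `moebius_fromBlocks`).
[cite: Rogawski1990, §4.8 Case (a) p. 53; §4.9 p. 55] -/
theorem coe_endoEmbLocal_eq_moebius
    (γH γH' : (cmDatum L 2 (Matrix.of fun i j : Fin 2 => if i.val + j.val + 1 = 2 then (1 : L) else 0)).Local v ×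
      (cmDatum L 1 (Matrix.of fun i j : Fin 1 => if i.val + j.val + 1 = 1 then (1 : L) else 0)).Local v)
    (c : LocalRing L v)
    (h1 : ((γH'.1.val : GL (Fin 2) (LocalRing L v)).val : Matrix (Fin 2) (Fin 2) (LocalRing L v)) =
      ((c + 1) • ((γH.1.val : GL (Fin 2) (LocalRing L v)).val : Matrix (Fin 2) (Fin 2) (LocalRing L v)) + (c - 1) • 1) *
        ((c - 1) • ((γH.1.val : GL (Fin 2) (LocalRing L v)).val : Matrix (Fin 2) (Fin 2) (LocalRing L v)) + (c + 1) • 1)⁻¹)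
    (h2 : ((γH'.2.val : GL (Fin 1) (LocalRing L v)).val : Matrix (Fin 1) (Fin 1) (LocalRing L v)) =
      ((c + 1) • ((γH.2.val : GL (Fin 1) (LocalRing L v)).val : Matrix (Fin 1) (Fin 1) (LocalRing L v)) + (c - 1) • 1) *
        ((c - 1) • ((γH.2.val : GL (Fin 1) (LocalRing L v)).val : Matrix (Fin 1) (Fin 1) (LocalRing L v)) + (c + 1) • 1)⁻¹)
    (hD1 : IsUnit ((c - 1) • ((γH.1.val : GL (Fin 2) (LocalRing L v)).val : Matrix (Fin 2) (Fin 2) (LocalRing L v)) + (c + 1) • (1 : Matrix (Fin 2) (Fin 2) (LocalRing L v))).det)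
    (hD2 : IsUnit ((c - 1) • ((γH.2.val : GL (Fin 1) (LocalRing L v)).val : Matrix (Fin 1) (Fin 1) (LocalRing L v)) + (c + 1) • (1 : Matrix (Fin 1) (Fin 1) (LocalRing L v))).det) :
    (((endoEmbLocal L v γH').val : GL (Fin 3) (LocalRing L v)).val : Matrix (Fin 3) (Fin 3) (LocalRing L v)) =
      ((c + 1) • (((endoEmbLocal L v γH).val : GL (Fin 3) (LocalRing L v)).val : Matrix (Fin 3) (Fin 3) (LocalRing L v)) + (c - 1) • 1) *
        ((c - 1) • (((endoEmbLocal L v γH).val : GL (Fin 3) (LocalRing L v)).val : Matrix (Fin 3) (Fin 3) (LocalRing L v)) + (c + 1) • 1)⁻¹ := by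
  have e1 : (((endoEmbLocal L v γH').val : GL (Fin 3) (LocalRing L v)).val : Matrix (Fin 3) (Fin 3) (LocalRing L v)) =
      Matrix.reindex endoPerm endoPerm (Matrix.fromBlocks ((γH'.1.val : GL (Fin 2) (LocalRing L v)).val) 0 0 ((γH'.2.val : GL (Fin 1) (LocalRing L v)).val)) := by
    rw [coe_endoEmbLocal, coe_endoGL]
  have e0 : (((endoEmbLocal L v γH).val : GL (Fin 3) (LocalRing L v)).val : Matrix (Fin 3) (Fin 3) (LocalRing L v)) =
      Matrix.reindex endoPerm endoPerm (Matrix.fromBlocks ((γH.1.val : GL (Fin 2) (LocalRing L v)).val) 0 0 ((γH.2.val : GL (Fin 1) (LocalRing L v)).val)) := by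
    rw [coe_endoEmbLocal, coe_endoGL]
  rw [e1, e0, moebius_reindex, moebius_fromBlocks _ _ _ _ hD1 hD2, h1, h2]

/-- **Matching is kept**: `ι_v(γ_H) ↔ δ ⇒ ι_v(γ_H′) ↔ δ′` when `ι_v(γ_H′) = φ(ι_v(γ_H))` and `δ′ = φ(δ)` as matrices (★ α `moebius_conj`). [cite: Rogawski1990, §4.9 p. 54; §14.1 p. 232] -/
theorem isLocalNormPair_of_coe_eq_moebius (H' : Matrix (Fin 3) (Fin 3) L)
    (γH γH' : (cmDatum L 2 (Matrix.of fun i j : Fin 2 => if i.val + j.val + 1 = 2 then (1 : L) else 0)).Local v ×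
      (cmDatum L 1 (Matrix.of fun i j : Fin 1 => if i.val + j.val + 1 = 1 then (1 : L) else 0)).Local v)
    (δ δ' : (cmDatum L 3 H').Local v) (c : LocalRing L v) (h : IsLocalNormPair L H' v γH δ)
    (hι : (((endoEmbLocal L v γH').val : GL (Fin 3) (LocalRing L v)).val : Matrix (Fin 3) (Fin 3) (LocalRing L v)) =
      ((c + 1) • (((endoEmbLocal L v γH).val : GL (Fin 3) (LocalRing L v)).val : Matrix (Fin 3) (Fin 3) (LocalRing L v)) + (c - 1) • 1) *
        ((c - 1) • (((endoEmbLocal L v γH).val : GL (Fin 3) (LocalRing L v)).val : Matrix (Fin 3) (Fin 3) (LocalRing L v)) + (c + 1) • 1)⁻¹)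
    (hδ : ((δ'.val : GL (Fin 3) (LocalRing L v)).val : Matrix (Fin 3) (Fin 3) (LocalRing L v)) =
      ((c + 1) • ((δ.val : GL (Fin 3) (LocalRing L v)).val : Matrix (Fin 3) (Fin 3) (LocalRing L v)) + (c - 1) • 1) *
        ((c - 1) • ((δ.val : GL (Fin 3) (LocalRing L v)).val : Matrix (Fin 3) (Fin 3) (LocalRing L v)) + (c + 1) • 1)⁻¹)
    (hD : IsUnit ((c - 1) • (((endoEmbLocal L v γH).val : GL (Fin 3) (LocalRing L v)).val : Matrix (Fin 3) (Fin 3) (LocalRing L v)) + (c + 1) • (1 : Matrix (Fin 3) (Fin 3) (LocalRing L v))).det) :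
    IsLocalNormPair L H' v γH' δ' := by
  obtain ⟨x, hx⟩ := isConj_iff.1 h
  refine isConj_iff.2 ⟨x, Units.ext ?_⟩
  have hxm : ((δ.val : GL (Fin 3) (LocalRing L v)).val : Matrix (Fin 3) (Fin 3) (LocalRing L v)) =
      x.val * (((endoEmbLocal L v γH).val : GL (Fin 3) (LocalRing L v)).val : Matrix (Fin 3) (Fin 3) (LocalRing L v)) * x.val⁻¹ := by
    rw [← hx, Units.val_mul, Units.val_mul, Matrix.coe_units_inv]
    rfl
  rw [Units.val_mul, Units.val_mul, Matrix.coe_units_inv]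
  change x.val * (((endoEmbLocal L v γH').val : GL (Fin 3) (LocalRing L v)).val) * x.val⁻¹ =
    ((δ'.val : GL (Fin 3) (LocalRing L v)).val : Matrix (Fin 3) (Fin 3) (LocalRing L v))
  rw [hι, hδ, hxm, moebius_conj _ _ (Matrix.isUnits_det_units x) _ _ hD]

/-- **`γ₂′ = φ(γ₂)`** on the `U(Φ₁)`-coordinate: `finGammaTwo γ_H′ = ((c+1)u + (c−1))·((c−1)u + (c+1))⁻¹`, `u = finGammaTwo γ_H`. [cite: Rogawski1990, §4.9 p. 55] -/
theorem finGammaTwo_of_coe_eq_moebius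
    (γH γH' : (cmDatum L 2 (Matrix.of fun i j : Fin 2 => if i.val + j.val + 1 = 2 then (1 : L) else 0)).Local v ×
      (cmDatum L 1 (Matrix.of fun i j : Fin 1 => if i.val + j.val + 1 = 1 then (1 : L) else 0)).Local v)
    (c : LocalRing L v)
    (h2 : ((γH'.2.val : GL (Fin 1) (LocalRing L v)).val : Matrix (Fin 1) (Fin 1) (LocalRing L v)) =
      ((c + 1) • ((γH.2.val : GL (Fin 1) (LocalRing L v)).val : Matrix (Fin 1) (Fin 1) (LocalRing L v)) + (c - 1) • 1) *
        ((c - 1) • ((γH.2.val : GL (Fin 1) (LocalRing L v)).val : Matrix (Fin 1) (Fin 1) (LocalRing L v)) + (c + 1) • 1)⁻¹) :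
    finGammaTwo L v γH' = ((c + 1) * finGammaTwo L v γH + (c - 1)) * Ring.inverse ((c - 1) * finGammaTwo L v γH + (c + 1)) := by
  unfold finGammaTwo
  rw [show (γH'.2.val.val : Matrix (Fin 1) (Fin 1) (LocalRing L v)) = ((γH'.2.val : GL (Fin 1) (LocalRing L v)).val : Matrix (Fin 1) (Fin 1) (LocalRing L v)) from rfl, h2,
    moebius_fin_one_apply]

/-- **κ IS KEPT**: `κ_v(γ_H′, δ′) = κ_v(γ_H, δ)` — the `γ₂`-eigenvector `p′` of `δ` is the `γ₂′`-eigenvector of `δ′ = φ(δ)` (★ α eigenvector rule) and κ is read on the `H′_v`-value of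
ANY such eigenvector (★ `finKappaAt_eq_ite_of_eigenvector`), the same value for both pairs. [cite: Rogawski1990, §14.6 p. 242; §4.3 p. 43] [cite: LanglandsShelstad1987, §1.3–1.4] -/
theorem finKappaAt_of_coe_eq_moebius (H' : Matrix (Fin 3) (Fin 3) L) (w : PlacesOver L v) (hw : IsCMField.complexConj L • w.1 = w.1)
    (γH γH' : (cmDatum L 2 (Matrix.of fun i j : Fin 2 => if i.val + j.val + 1 = 2 then (1 : L) else 0)).Local v ×
      (cmDatum L 1 (Matrix.of fun i j : Fin 1 => if i.val + j.val + 1 = 1 then (1 : L) else 0)).Local v)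
    (δ δ' : (cmDatum L 3 H').Local v) (c : LocalRing L v) (h : IsLocalNormPair L H' v γH δ) (h' : IsLocalNormPair L H' v γH' δ')
    (hreg : IsLocalGRegular L v γH) (hreg' : IsLocalGRegular L v γH')
    (hδ : ((δ'.val : GL (Fin 3) (LocalRing L v)).val : Matrix (Fin 3) (Fin 3) (LocalRing L v)) =
      ((c + 1) • ((δ.val : GL (Fin 3) (LocalRing L v)).val : Matrix (Fin 3) (Fin 3) (LocalRing L v)) + (c - 1) • 1) *
        ((c - 1) • ((δ.val : GL (Fin 3) (LocalRing L v)).val : Matrix (Fin 3) (Fin 3) (LocalRing L v)) + (c + 1) • 1)⁻¹)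
    (hu' : finGammaTwo L v γH' = ((c + 1) * finGammaTwo L v γH + (c - 1)) * Ring.inverse ((c - 1) * finGammaTwo L v γH + (c + 1)))
    (hDδ : IsUnit ((c - 1) • ((δ.val : GL (Fin 3) (LocalRing L v)).val : Matrix (Fin 3) (Fin 3) (LocalRing L v)) + (c + 1) • (1 : Matrix (Fin 3) (Fin 3) (LocalRing L v))).det)
    (hu : IsUnit ((c - 1) * finGammaTwo L v γH + (c + 1))) (hκ : finKappaAt L v H' γH δ ≠ 0) :
    finKappaAt L v H' γH' δ' = finKappaAt L v H' γH δ := by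
  have hv : Subsingleton (PlacesOver L v) := PlacesOver.subsingleton_of_smul_eq (IsCMField.complexConj L) (IsCMField.complexConj_ne_one L) w hw
  obtain ⟨p', hne, hp'⟩ := exists_eigenvector_of_finKappaAt_ne_zero L v H' γH δ h hκ
  have hu0 : IsUnit ((finCharpolyTwo L v γH).eval (finGammaTwo L v γH)) := isUnit_eval_finCharpolyTwo_of_isLocalGRegular L v γH hreg
  have hu0' : IsUnit ((finCharpolyTwo L v γH').eval (finGammaTwo L v γH')) := isUnit_eval_finCharpolyTwo_of_isLocalGRegular L v γH' hreg'
  have hp'' : ((δ'.val.val : Matrix (Fin 3) (Fin 3) (LocalRing L v))) *ᵥ p' = finGammaTwo L v γH' • p' := by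
    rw [show (δ'.val.val : Matrix (Fin 3) (Fin 3) (LocalRing L v)) = ((δ'.val : GL (Fin 3) (LocalRing L v)).val : Matrix (Fin 3) (Fin 3) (LocalRing L v)) from rfl, hδ, hu',
      moebius_mulVec_of_eigenvector_ring hp' hu hDδ]
  rw [finKappaAt_eq_ite_of_eigenvector L v H' γH' δ' hv h' hu0' hp'' hne, finKappaAt_eq_ite_of_eigenvector L v H' γH δ hv h hu0 hp' hne]

end Carriers


/-! ## §3 At the place `w`: unitarity of the avatars, and the ★ value theorems' binders for `γ_H′` at the shifted exponents -/

section Place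

variable (L : Type) [Field L] [NumberField L] [IsCMField L] (v : HeightOneSpectrum (𝓞 ↥(maximalRealSubfield L)))
  (w : PlacesOver L v) (hw : IsCMField.complexConj L • w.1 = w.1)

/-- **The `w`-avatar of the `U(Φ₂)`-coordinate is unitary for `Φ₂,w`**: `ᵗ(σ_w g_w)·Φ₂,w·g_w = Φ₂,w` (one-place model ★ `localNonsplitEquiv`; `Φ₂,w = antidiag(1,1)` is ★
`placeForm_antidiagTwo_eq`). [cite: Rogawski1990, §1.9 p. 8; §4.9 p. 54] -/
theorem transpose_map_fst_evalRingHom_mul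
    (γH : (cmDatum L 2 (Matrix.of fun i j : Fin 2 => if i.val + j.val + 1 = 2 then (1 : L) else 0)).Local v ×
      (cmDatum L 1 (Matrix.of fun i j : Fin 1 => if i.val + j.val + 1 = 1 then (1 : L) else 0)).Local v) :
    (((γH.1.val : GL (Fin 2) (LocalRing L v)).val.map (Pi.evalRingHom (fun w' : PlacesOver L v => w'.1.adicCompletion L) w)).map
        (galAdicCompletionMap (L := L) (IsCMField.complexConj L) hw))ᵀ *
        UnitaryGroup.placeForm (Matrix.of fun i j : Fin 2 => if i.val + j.val + 1 = 2 then (1 : L) else 0) w.1 *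
      ((γH.1.val : GL (Fin 2) (LocalRing L v)).val.map (Pi.evalRingHom (fun w' : PlacesOver L v => w'.1.adicCompletion L) w)) =
      UnitaryGroup.placeForm (Matrix.of fun i j : Fin 2 => if i.val + j.val + 1 = 2 then (1 : L) else 0) w.1 :=
  (localNonsplitEquiv (IsCMField.complexConj L) (Matrix.of fun i j : Fin 2 => if i.val + j.val + 1 = 2 then (1 : L) else 0)
    (IsCMField.complexConj_ne_one L) w hw γH.1).2

/-- **The `w`-avatar of the `U(Φ₁)`-coordinate has norm one**: `σ_w(u_w)·u_w = 1`. [cite: Rogawski1990, §4.9 p. 54] -/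
theorem map_finGammaTwo_mul_finGammaTwo
    (γH : (cmDatum L 2 (Matrix.of fun i j : Fin 2 => if i.val + j.val + 1 = 2 then (1 : L) else 0)).Local v ×
      (cmDatum L 1 (Matrix.of fun i j : Fin 1 => if i.val + j.val + 1 = 1 then (1 : L) else 0)).Local v) :
    galAdicCompletionMap (L := L) (IsCMField.complexConj L) hw (finGammaTwo L v γH w) * finGammaTwo L v γH w = 1 := by
  have hmat : (((γH.2.val : GL (Fin 1) (LocalRing L v)).val.map (Pi.evalRingHom (fun w' : PlacesOver L v => w'.1.adicCompletion L) w)).map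
        (galAdicCompletionMap (L := L) (IsCMField.complexConj L) hw))ᵀ *
        UnitaryGroup.placeForm (Matrix.of fun i j : Fin 1 => if i.val + j.val + 1 = 1 then (1 : L) else 0) w.1 *
      ((γH.2.val : GL (Fin 1) (LocalRing L v)).val.map (Pi.evalRingHom (fun w' : PlacesOver L v => w'.1.adicCompletion L) w)) =
      UnitaryGroup.placeForm (Matrix.of fun i j : Fin 1 => if i.val + j.val + 1 = 1 then (1 : L) else 0) w.1 :=
    (localNonsplitEquiv (IsCMField.complexConj L) (Matrix.of fun i j : Fin 1 => if i.val + j.val + 1 = 1 then (1 : L) else 0)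
      (IsCMField.complexConj_ne_one L) w hw γH.2).2
  have h1 : UnitaryGroup.placeForm (Matrix.of fun i j : Fin 1 => if i.val + j.val + 1 = 1 then (1 : L) else 0) w.1 = !![(1 : w.1.adicCompletion L)] := by
    ext i j; fin_cases i; fin_cases j; simp [UnitaryGroup.placeForm, Matrix.map_apply]
  rw [h1] at hmat
  have h00 := congrFun (congrFun hmat 0) 0
  simp only [Matrix.mul_apply, Fin.sum_univ_one, Matrix.transpose_apply, Matrix.map_apply, Matrix.of_apply, Matrix.cons_val', Matrix.cons_val_fin_one,
    Matrix.empty_val', mul_one] at h00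
  -- `h00 : σ_w (γ₂)_w * (γ₂)_w = 1` in the avatar's coordinates, which are `finGammaTwo … w` by `rfl`
  exact h00

end Place

end Literature.NumberTheory.Rogawski1990

end
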